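import Literature.Barriers.HubbardSuperconductivity.HohenbergMerminWagnerPairing
import Literature.MathematicalPhysics.QuantumLattice.HubbardGaugeBoundTTPrime
import Literature.MathematicalPhysics.QuantumLattice.TorusEuclidLogDipoleDiag
import Mathlib.NumberTheory.Harmonic.Bounds
import HarnessLib

/-!
# Koma–Tasaki decay of bond-pair and pair-field correlations, sharp constants: the `t–t'` model

Trunk T-QLATTICE (family `hubbard`; consumer: the cell file
`Summits/HubbardSuperconductivity/HubbardLadder/Bounds/PairFieldEtaLineEuclidTPrime.lean`;
nearest-neighbour companion: `HubbardBondPairDecaySharp.lean`).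

Koma–Tasaki (PRL 68 (1992) 3248), note 9: the Theorem extends to finite-range hopping, each bond
family entering the cost with its own amplitude; footnote [10]: it applies to other pairing
operators, in particular to the singlet bond pairs `b_{uv} = c_{u↑}c_{v↓} - c_{u↓}c_{v↑}` of the
`d_{x²-y²}` pair field `P_x = Σ_e (g e/√2) b_{x,x+e}` (Scalapino 1995 §2; Su–Suzuki 1998). For
the grand-canonical `t–t'` Hubbard model `H_{t,t'}(U) - μN` on `(ℤ/Lℤ)²` (Xu et al. 2024,
eq. (1)) this file proves, with the PRINTED hopping norm and the explicit Euclidean truncated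
logarithmic dipole on BOTH bond graphs (McBryan–Spencer coefficients `2π`, `4π`):

* `norm_thermalCorr_bondPair_le_exp_two_graphs` — a priori bound for bond pairs and a two-graph
  hopping on an arbitrary finite vertex set:
  `|⟨(b_{uv})† b_{wz}⟩_β| ≤ 4 e^{-(φ_u+φ_v)+(φ_w+φ_z)} exp[β(|t₁| Σ₁ + |t₂| Σ₂)(cosh(φ_a-φ_b)-1)]`;
* `norm_thermalCorr_bondPair_ttPrime_le_exp_sharp` — its torus form for potentials flat on the
  two bonds (gauge charge `2`): `≤ 4 e^{-2(φ_x-φ_y)} exp[β(|t| Σ_{n.n.} + |t'| Σ_{diag})(cosh-1)]`;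
* `exists_euclidLogDipole_two_graphs_flat` — the dipole of `exists_euclidLogDipole_two_graphs`
  (gain `2q log ρ`, energies `≤ 2(2πq²H(ρ)+76q²+544q⁴e^{2q²})` and
  `≤ 2(4πq²H(ρ)+289q²+3402q⁴e^{2q²})`) is constant on `{u : |u-x|₂² ≤ 1}` and `{v : |v-y|₂² ≤ 1}`;
* `le_rpow_euclid_two_graphs_of_apriori_flat` — generic step: a flat two-graph a priori bound
  with charge `c`, cost `b(a₁ Σ_{n.n.} + a₂ Σ_{diag})` gives `g ≤ K 5^f (dist+1)^{-f}`,
  `f = 2cq - 4πb(a₁+2a₂)q²`;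
* `norm_thermalCorr_localPair_ttPrime_le_sharp` — for EVERY form factor `g`, all real
  `t, t', U, μ`, `β ≥ 0`, `q ≥ 0` with `f := 4q - 4πβ(|t|+2|t'|)q² ≥ 0`, uniformly in `L`:
  `|⟨(P_x)† P_y⟩_{β,L}| ≤ 4(Σ_e |g e/√2|)² K(q) 5^f (dist(x,y)+1)^{-f}`,
  `K(q) = exp[2β(|t|(2πq²+76q²+544q⁴e^{2q²}) + |t'|(4πq²+289q²+3402q⁴e^{2q²}))]`; at
  `q = 1/(2πβ(|t|+2|t'|))` the exponent is `T/(π(|t|+2|t'|))`.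

Sources: T. Koma, H. Tasaki, PRL 68 (1992) 3248, Theorem, eqs. (5)–(13), note 9, footnote [10];
O. A. McBryan, T. Spencer, Commun. Math. Phys. 53 (1977) 299; G. Su, M. Suzuki, PRB 58 (1998)
117; D. J. Scalapino, Phys. Rep. 250 (1995) 329, §2; H. Xu et al., Science 384 (2024) eadh7691,
eq. (1).

## Mathlib / tree search

Tree: `bondPair`, `siteGauge_mul_bondPairCorr_mul`, `norm_bondPairCorr_le_four`,
`thermalCorr_localPair_eq`, `apply_mem_insert_unitSteps`, `torusNorm_proj_le_one`
(`HohenbergMerminWagnerPairing`); `norm_hoppingPerturbation_le_sharp`,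
`hubbardTorusTT'_sub_chemicalPotential` (`HubbardGaugeBoundSharp`, `HubbardGaugeBoundTTPrime`);
`norm_gibbsState_le_of_gauge`, `siteGauge_conj_hamiltonianWith_add_conjTranspose`;
`euclidLogProfile`, `euclidLogMonopole_energy_le`, `euclidLogMonopole_diagEnergy_le`,
`torusDist_le_one_of_diagAdj`, `torusDist_le_of_adj`, `torusNorm_two_eq_max`.
Mathlib: `harmonic_le_one_add_log`.

## Design notes

Mirrors `HubbardBondPairDecaySharp.lean` with the two-graph cost; the flat dipole is rebuilt from
the public profile `euclidLogProfile` and the two public monopole energy bounds (the splitting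
lemma of `TorusEuclidLogDipoleDiag` is private and is re-proved here).
-/

noncomputable section

namespace Literature.MathematicalPhysics.QuantumLattice

open Matrix Finset NormedSpace Literature.Probability.LatticeModels
  Literature.Barriers.HubbardSuperconductivity
open scoped Matrix.Norms.L2Operator ComplexOrder

/-! ### The two-graph a priori bound for bond pairs -/

section TwoGraphs

variable {Λ : Type*} [LinearOrder Λ] [Fintype Λ]
  (G₁ : SimpleGraph Λ) [DecidableRel G₁.Adj] (G₂ : SimpleGraph Λ) [DecidableRel G₂.Adj]

/-- **Koma–Tasaki's a priori bound for bond pairs and a two-graph hopping, printed constant**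
(eqs. (6)–(12) before the choice of `φ`, note 9, footnote [10]): for
`H = (H_{G₁}(t₁,U₁) - μ₁N) + (H_{G₂}(t₂,U₂) - μ₂N)`, every real `φ`, `β ≥ 0` and sites
`u, v, w, z`:
`|⟨(b_{uv})† b_{wz}⟩_β| ≤ 4 e^{-(φ_u+φ_v)+(φ_w+φ_z)} exp[β(|t₁| Σ_a Σ_b [a∼₁b] + |t₂| Σ_a Σ_b [a∼₂b])(cosh(φ_a-φ_b)-1)]`.
[cite: KomaTasakiPRL1992, eqs. (6)–(12), note 9 and footnote [10]] -/
theorem norm_thermalCorr_bondPair_le_exp_two_graphs (t₁ U₁ μ₁ t₂ U₂ μ₂ : ℝ) {β : ℝ}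
    (hβ : 0 ≤ β) (φ : Λ → ℝ) (u v w z : Λ) :
    ‖(hamiltonianWith G₁ t₁ U₁ μ₁ + hamiltonianWith G₂ t₂ U₂ μ₂).thermalCorr β
        (bondPair u v)ᴴ (bondPair w z)‖ ≤
      4 * Real.exp (-(φ u + φ v) + (φ w + φ z)) *
        Real.exp (β * (|t₁| * (∑ a : Λ, ∑ b : Λ,
            if G₁.Adj a b then (Real.cosh (φ a - φ b) - 1) else 0) +
          |t₂| * ∑ a : Λ, ∑ b : Λ,
            if G₂.Adj a b then (Real.cosh (φ a - φ b) - 1) else 0)) := by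
  have h1 := siteGauge_conj_hamiltonianWith_add_conjTranspose G₁ φ t₁ U₁ μ₁
  have h2 := siteGauge_conj_hamiltonianWith_add_conjTranspose G₂ φ t₂ U₂ μ₂
  set H₁ : Matrix (Finset (Orb Λ)) (Finset (Orb Λ)) ℂ := hamiltonianWith G₁ t₁ U₁ μ₁ with hH₁
  set H₂ : Matrix (Finset (Orb Λ)) (Finset (Orb Λ)) ℂ := hamiltonianWith G₂ t₂ U₂ μ₂ with hH₂
  set V₁ : Matrix (Finset (Orb Λ)) (Finset (Orb Λ)) ℂ :=
    -(t₁ : ℂ) • hoppingForm G₁ (fun a b => Real.cosh (φ a - φ b) - 1) with hV₁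
  set V₂ : Matrix (Finset (Orb Λ)) (Finset (Orb Λ)) ℂ :=
    -(t₂ : ℂ) • hoppingForm G₂ (fun a b => Real.cosh (φ a - φ b) - 1) with hV₂
  set A : Matrix (Finset (Orb Λ)) (Finset (Orb Λ)) ℂ := (bondPair u v)ᴴ * bondPair w z
    with hA_def
  set c : ℝ := |t₁| * (∑ a : Λ, ∑ b : Λ,
      if G₁.Adj a b then (Real.cosh (φ a - φ b) - 1) else 0) +
    |t₂| * ∑ a : Λ, ∑ b : Λ, if G₂.Adj a b then (Real.cosh (φ a - φ b) - 1) else 0 with hc_def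
  set κ : ℝ := Real.exp (-(φ u + φ v) + (φ w + φ z)) with hκ_def
  have hH : (H₁ + H₂).IsHermitian :=
    (isHermitian_hamiltonianWith G₁ t₁ U₁ μ₁).add (isHermitian_hamiltonianWith G₂ t₂ U₂ μ₂)
  have hD : IsUnit (siteGauge φ) := isUnit_siteGauge φ
  have hA : siteGauge φ * A * (siteGauge φ)⁻¹ = ((κ : ℝ) : ℂ) • A := by
    rw [siteGauge_inv]
    exact siteGauge_mul_bondPairCorr_mul φ u v w z
  have hV : siteGauge φ * (H₁ + H₂) * (siteGauge φ)⁻¹ +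
      (siteGauge φ * (H₁ + H₂) * (siteGauge φ)⁻¹)ᴴ = (2 : ℂ) • ((H₁ + H₂) + (V₁ + V₂)) := by
    rw [siteGauge_inv, Matrix.mul_add, Matrix.add_mul, conjTranspose_add]
    calc siteGauge φ * H₁ * siteGauge (-φ) + siteGauge φ * H₂ * siteGauge (-φ) +
          ((siteGauge φ * H₁ * siteGauge (-φ))ᴴ + (siteGauge φ * H₂ * siteGauge (-φ))ᴴ)
        = (siteGauge φ * H₁ * siteGauge (-φ) + (siteGauge φ * H₁ * siteGauge (-φ))ᴴ) +
          (siteGauge φ * H₂ * siteGauge (-φ) + (siteGauge φ * H₂ * siteGauge (-φ))ᴴ) := by abel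
      _ = (2 : ℂ) • (H₁ + V₁) + (2 : ℂ) • (H₂ + V₂) := by rw [h1, h2]
      _ = (2 : ℂ) • ((H₁ + H₂) + (V₁ + V₂)) := by module
  have hc : ‖V₁ + V₂‖ ≤ c :=
    (norm_add_le _ _).trans (add_le_add (norm_hoppingPerturbation_le_sharp G₁ φ t₁)
      (norm_hoppingPerturbation_le_sharp G₂ φ t₂))
  have h := norm_gibbsState_le_of_gauge hH hD hA hV hc hβ
  have hκ : ‖((κ : ℝ) : ℂ)‖ = κ := by
    rw [Complex.norm_real, Real.norm_of_nonneg (Real.exp_pos _).le]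
  have hthermal : (H₁ + H₂).thermalCorr β (bondPair u v)ᴴ (bondPair w z) =
      gibbsState β (H₁ + H₂) A := rfl
  rw [hthermal]
  calc ‖gibbsState β (H₁ + H₂) A‖
      ≤ ‖((κ : ℝ) : ℂ)‖ * ‖A‖ * Real.exp (β * c) := h
    _ ≤ ‖((κ : ℝ) : ℂ)‖ * 4 * Real.exp (β * c) := by
        gcongr
        exact norm_bondPairCorr_le_four u v w z
    _ = 4 * κ * Real.exp (β * c) := by rw [hκ]; ring

end TwoGraphs

/-! ### Torus form for the grand-canonical `t–t'` model, flat potentials -/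

section Torus

variable {L : ℕ} [NeZero L]

/-- **The printed a priori bound for bond pairs of the `t–t'` model on `(ℤ/Lℤ)²`, flat
potentials.** If `φ x' = φ x` and `φ y' = φ y`, then for `β ≥ 0` and all real `t, t', U, μ`:
`|⟨(b_{xx'})† b_{yy'}⟩_{β,L}| ≤ 4 e^{-2(φ_x-φ_y)} exp[β(|t| Σ_{n.n.} + |t'| Σ_{diag})(cosh(φ_u-φ_v)-1)]`.
[cite: KomaTasakiPRL1992, eqs. (6)–(12), note 9 and footnote [10]] [cite: XuEtAl2024, eq. (1)] -/
theorem norm_thermalCorr_bondPair_ttPrime_le_exp_sharp (L : ℕ) [NeZero L] (t t' U μ : ℝ)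
    {β : ℝ} (hβ : 0 ≤ β) (φ : TorusSite 2 L → ℝ) (x x' y y' : TorusSite 2 L)
    (hx' : φ x' = φ x) (hy' : φ y' = φ y) :
    ‖(hubbardTorusTT' L t t' U - (μ : ℂ) • totalNumber).thermalCorr β
        (bondPair (FermionTorus.ofTorusSite x) (FermionTorus.ofTorusSite x'))ᴴ
        (bondPair (FermionTorus.ofTorusSite y) (FermionTorus.ofTorusSite y'))‖ ≤
      4 * (Real.exp (-(2 * (φ x - φ y))) * Real.exp (β * (|t| *
          (∑ a : TorusSite 2 L, ∑ b : TorusSite 2 L,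
            (if (torusGraph 2 L).Adj a b then (Real.cosh (φ a - φ b) - 1) else 0)) +
        |t'| * ∑ a : TorusSite 2 L, ∑ b : TorusSite 2 L,
            (if (torusDiagGraph L).Adj a b then (Real.cosh (φ a - φ b) - 1) else 0)))) := by
  have key := norm_thermalCorr_bondPair_le_exp_two_graphs (fermionTorusGraph 2 L)
    (fermionTorusDiagGraph L) t U μ t' 0 0 hβ (fun u => φ (FermionTorus.toTorusSite u))
    (FermionTorus.ofTorusSite x) (FermionTorus.ofTorusSite x') (FermionTorus.ofTorusSite y)
    (FermionTorus.ofTorusSite y')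
  have hsum₁ : (∑ u : FermionTorus 2 L, ∑ v : FermionTorus 2 L,
      if (fermionTorusGraph 2 L).Adj u v then
        (Real.cosh (φ (FermionTorus.toTorusSite u) - φ (FermionTorus.toTorusSite v)) - 1)
      else 0) =
      ∑ a : TorusSite 2 L, ∑ b : TorusSite 2 L,
        if (torusGraph 2 L).Adj a b then (Real.cosh (φ a - φ b) - 1) else 0 := by
    refine Fintype.sum_equiv FermionTorus.equivTorusSite _ _ fun u => ?_
    refine Fintype.sum_equiv FermionTorus.equivTorusSite _ _ fun v => ?_
    simp [FermionTorus.equivTorusSite]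
  have hsum₂ : (∑ u : FermionTorus 2 L, ∑ v : FermionTorus 2 L,
      if (fermionTorusDiagGraph L).Adj u v then
        (Real.cosh (φ (FermionTorus.toTorusSite u) - φ (FermionTorus.toTorusSite v)) - 1)
      else 0) =
      ∑ a : TorusSite 2 L, ∑ b : TorusSite 2 L,
        if (torusDiagGraph L).Adj a b then (Real.cosh (φ a - φ b) - 1) else 0 := by
    refine Fintype.sum_equiv FermionTorus.equivTorusSite _ _ fun u => ?_
    refine Fintype.sum_equiv FermionTorus.equivTorusSite _ _ fun v => ?_
    simp [FermionTorus.equivTorusSite, fermionTorusDiagGraph, SimpleGraph.comap_adj]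
  simp only [FermionTorus.toTorusSite_ofTorusSite] at key
  rw [hsum₁, hsum₂, hx', hy', ← hubbardTorusTT'_sub_chemicalPotential] at key
  have h2 : -(φ x + φ x) + (φ y + φ y) = -(2 * (φ x - φ y)) := by ring
  rw [h2] at key
  refine Eq.trans_le ?_ (key.trans_eq ?_)
  · congr!
  · ring

/-! ### The flat Euclidean dipole on both bond graphs -/

omit [NeZero L] in
/-- `‖z‖_∞² ≤ |z|₂²`. [folklore] -/
private theorem torusNorm_sq_le_torusNormSqT (z : TorusSite 2 L) :
    torusNorm z ^ 2 ≤ torusNormSq z := by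
  rw [torusNorm_two_eq_max, torusNormSq]
  rcases le_total (min (z 0).val (L - (z 0).val)) (min (z 1).val (L - (z 1).val)) with h | h
  · rw [max_eq_right h]; exact Nat.le_add_left _ _
  · rw [max_eq_left h]; exact Nat.le_add_right _ _

omit [NeZero L] in
/-- `|u - c|₂² ≤ 1 ⟹ dist_∞(u, c) ≤ 1`. [folklore] -/
private theorem torusDist_le_one_of_torusNormSq_le_oneT {u c : TorusSite 2 L}
    (h : torusNormSq (u - c) ≤ 1) : torusDist u c ≤ 1 := by
  have h2 : torusDist u c ^ 2 ≤ 1 := (torusNorm_sq_le_torusNormSqT (u - c)).trans h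
  nlinarith [Nat.zero_le (torusDist u c)]

/-- `g_N(n) = 0` for `n ≤ 1`. [folklore] -/
private theorem euclidLogProfile_of_le_oneT (N n : ℕ) (hn : n ≤ 1) :
    euclidLogProfile N n = 0 := by
  unfold euclidLogProfile
  have : max 1 (min n N) = 1 := by omega
  rw [this]
  simp

/-- `g_{ρ²}(n) = log ρ` for `ρ² ≤ n`, `ρ ≥ 1`. [folklore] -/
private theorem euclidLogProfile_satT (ρ n : ℕ) (hρ : 1 ≤ ρ) (hn : ρ ^ 2 ≤ n) :
    euclidLogProfile (ρ ^ 2) n = Real.log ρ := by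
  unfold euclidLogProfile
  have h1 : 1 ≤ ρ ^ 2 := Nat.one_le_pow _ _ hρ
  rw [min_eq_right hn, max_eq_right h1]
  push_cast
  rw [Real.log_pow]
  ring

/-- Bondwise splitting of the dipole energy on disjoint supports, for any bond graph whose bonds
have `ℓ^∞`-length `≤ 1` (re-proof of the private splitting lemma of `TorusEuclidLogDipoleDiag`).
[folklore] -/
private theorem dipole_energy_splitT (G : SimpleGraph (TorusSite 2 L)) [DecidableRel G.Adj]
    (x y : TorusSite 2 L) (q : ℝ) (ρ : ℕ) (hρ1 : 1 ≤ ρ) (hρ : 2 * ρ + 1 ≤ torusDist x y)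
    (hadj : ∀ u v, G.Adj u v →
      torusDist u y ≤ torusDist v y + 1 ∧ torusDist v y ≤ torusDist u y + 1) :
    ∑ u : TorusSite 2 L, ∑ v : TorusSite 2 L, (if G.Adj u v then
        (Real.cosh ((q * euclidLogProfile (ρ ^ 2) (torusNormSq (u - y)) -
              q * euclidLogProfile (ρ ^ 2) (torusNormSq (u - x))) -
            (q * euclidLogProfile (ρ ^ 2) (torusNormSq (v - y)) -
              q * euclidLogProfile (ρ ^ 2) (torusNormSq (v - x)))) - 1) else 0) =
      (∑ u : TorusSite 2 L, ∑ v : TorusSite 2 L, (if G.Adj u v then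
          (Real.cosh (q * euclidLogProfile (ρ ^ 2) (torusNormSq (u - y)) -
              q * euclidLogProfile (ρ ^ 2) (torusNormSq (v - y))) - 1) else 0)) +
        ∑ u : TorusSite 2 L, ∑ v : TorusSite 2 L, (if G.Adj u v then
          (Real.cosh (q * euclidLogProfile (ρ ^ 2) (torusNormSq (u - x)) -
              q * euclidLogProfile (ρ ^ 2) (torusNormSq (v - x))) - 1) else 0) := by
  set A : TorusSite 2 L → ℝ := fun u => q * euclidLogProfile (ρ ^ 2) (torusNormSq (u - y))
    with hA
  set B : TorusSite 2 L → ℝ := fun u => q * euclidLogProfile (ρ ^ 2) (torusNormSq (u - x))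
    with hB
  have hsat : ∀ u c : TorusSite 2 L, ρ ≤ torusDist u c →
      euclidLogProfile (ρ ^ 2) (torusNormSq (u - c)) = Real.log ρ := fun u c huc =>
    euclidLogProfile_satT ρ _ hρ1
      ((Nat.pow_le_pow_left huc 2).trans (torusNorm_sq_le_torusNormSqT (u - c)))
  have hsplit : ∀ u v, G.Adj u v →
      Real.cosh ((A u - B u) - (A v - B v)) - 1 =
        (Real.cosh (A u - A v) - 1) + (Real.cosh (B u - B v) - 1) := by
    intro u v huv
    have hre : (A u - B u) - (A v - B v) = (A u - A v) - (B u - B v) := by ring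
    rw [hre]
    by_cases hfar : ρ ≤ torusDist u y ∧ ρ ≤ torusDist v y
    · have hA0 : A u - A v = 0 := by
        simp only [hA, hsat u y hfar.1, hsat v y hfar.2, sub_self]
      rw [hA0, zero_sub, Real.cosh_neg, Real.cosh_zero, sub_self, zero_add]
    · have hd := hadj u v huv
      have huy : torusDist u y ≤ ρ := by omega
      have hvy : torusDist v y ≤ ρ := by omega
      have htu := torusDist_triangle' x u y
      have htv := torusDist_triangle' x v y
      rw [torusDist_comm' x u] at htu
      rw [torusDist_comm' x v] at htv
      have hux : ρ ≤ torusDist u x := by omega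
      have hvx : ρ ≤ torusDist v x := by omega
      have hB0 : B u - B v = 0 := by
        simp only [hB, hsat u x hux, hsat v x hvx, sub_self]
      rw [hB0, sub_zero, Real.cosh_zero, sub_self, add_zero]
  show ∑ u : TorusSite 2 L, ∑ v : TorusSite 2 L,
      (if G.Adj u v then (Real.cosh ((A u - B u) - (A v - B v)) - 1) else 0) =
    (∑ u : TorusSite 2 L, ∑ v : TorusSite 2 L,
      (if G.Adj u v then (Real.cosh (A u - A v) - 1) else 0)) +
    ∑ u : TorusSite 2 L, ∑ v : TorusSite 2 L,
      (if G.Adj u v then (Real.cosh (B u - B v) - 1) else 0)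
  rw [← sum_add_distrib]
  refine sum_congr rfl fun u _ => ?_
  rw [← sum_add_distrib]
  refine sum_congr rfl fun v _ => ?_
  split_ifs with huv
  · exact hsplit u v huv
  · simp

/-- **The flat Euclidean truncated logarithmic dipole on both bond graphs of the `t–t'`
lattice.** On `(ℤ/Lℤ)²`, for sites `x, y`, `q ≥ 0` and `ρ ≥ 1` with `2ρ + 1 ≤ dist_∞(x,y)`,
the dipole `φ = φ^{(y)} - φ^{(x)}`, `φ^{(c)}(u) = q g_{ρ²}(|u - c|₂²)`, has gain `2q log ρ`,
nearest-neighbour energy `≤ 2(2πq²H(ρ) + 76q² + 544q⁴e^{2q²})`, diagonal energy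
`≤ 2(4πq²H(ρ) + 289q² + 3402q⁴e^{2q²})`, and is constant on the unit `|·|₂`-neighbourhoods of
`x` and of `y`. Koma–Tasaki, PRL 68 (1992) 3248, proof of eq. (13) (P1–P2) with note 9.
[cite: KomaTasakiPRL1992, proof of eq. (13) (P1–P2) and note 9] -/
theorem exists_euclidLogDipole_two_graphs_flat (L : ℕ) [NeZero L] (x y : TorusSite 2 L)
    (q : ℝ) (hq : 0 ≤ q) (ρ : ℕ) (hρ1 : 1 ≤ ρ) (hρ : 2 * ρ + 1 ≤ torusDist x y) :
    ∃ φ : TorusSite 2 L → ℝ, φ x - φ y = 2 * q * Real.log ρ ∧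
      (∑ u : TorusSite 2 L, ∑ v : TorusSite 2 L,
          (if (torusGraph 2 L).Adj u v then (Real.cosh (φ u - φ v) - 1) else 0) ≤
        2 * (2 * Real.pi * q ^ 2 * (harmonic ρ : ℝ) + 76 * q ^ 2 +
          544 * q ^ 4 * Real.exp (2 * q ^ 2))) ∧
      (∑ u : TorusSite 2 L, ∑ v : TorusSite 2 L,
          (if (torusDiagGraph L).Adj u v then (Real.cosh (φ u - φ v) - 1) else 0) ≤
        2 * (4 * Real.pi * q ^ 2 * (harmonic ρ : ℝ) + 289 * q ^ 2 +
          3402 * q ^ 4 * Real.exp (2 * q ^ 2))) ∧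
      (∀ u : TorusSite 2 L, torusNormSq (u - x) ≤ 1 → φ u = φ x) ∧
      (∀ v : TorusSite 2 L, torusNormSq (v - y) ≤ 1 → φ v = φ y) := by
  classical
  set A : TorusSite 2 L → ℝ := fun u => q * euclidLogProfile (ρ ^ 2) (torusNormSq (u - y))
    with hA
  set B : TorusSite 2 L → ℝ := fun u => q * euclidLogProfile (ρ ^ 2) (torusNormSq (u - x))
    with hB
  have hsat : ∀ u c : TorusSite 2 L, ρ ≤ torusDist u c →
      euclidLogProfile (ρ ^ 2) (torusNormSq (u - c)) = Real.log ρ := fun u c huc =>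
    euclidLogProfile_satT ρ _ hρ1
      ((Nat.pow_le_pow_left huc 2).trans (torusNorm_sq_le_torusNormSqT (u - c)))
  have hxy : ρ ≤ torusDist x y := by omega
  have hyx : ρ ≤ torusDist y x := by rw [torusDist_comm']; exact hxy
  have hAx : A x = q * Real.log ρ := by simp only [hA, hsat x y hxy]
  have hBy : B y = q * Real.log ρ := by simp only [hB, hsat y x hyx]
  have hAy : A y = 0 := by
    simp only [hA, sub_self]
    rw [show torusNormSq (0 : TorusSite 2 L) = 0 by simp [torusNormSq],
      euclidLogProfile_of_le_oneT _ _ zero_le_one, mul_zero]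
  have hBx : B x = 0 := by
    simp only [hB, sub_self]
    rw [show torusNormSq (0 : TorusSite 2 L) = 0 by simp [torusNormSq],
      euclidLogProfile_of_le_oneT _ _ zero_le_one, mul_zero]
  refine ⟨fun u => A u - B u, ?_, ?_, ?_, ?_, ?_⟩
  · show (A x - B x) - (A y - B y) = 2 * q * Real.log ρ
    rw [hAx, hBy, hAy, hBx]
    ring
  · have hsplit := dipole_energy_splitT (torusGraph 2 L) x y q ρ hρ1 hρ
      (fun u v huv => torusDist_le_of_adj L huv y)
    have hmonoY := euclidLogMonopole_energy_le L y q hq ρ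
    have hmonoX := euclidLogMonopole_energy_le L x q hq ρ
    simp only [hA, hB]
    rw [hsplit]
    linarith
  · have hdiag : ∀ u v : TorusSite 2 L, (torusDiagGraph L).Adj u v →
        torusDist u y ≤ torusDist v y + 1 ∧ torusDist v y ≤ torusDist u y + 1 := by
      intro u v huv
      have h1 := torusDist_le_one_of_diagAdj huv
      have h2 := torusDist_triangle' u v y
      have h3 := torusDist_triangle' v u y
      rw [torusDist_comm' v u] at h3
      exact ⟨by omega, by omega⟩
    have hsplit := dipole_energy_splitT (torusDiagGraph L) x y q ρ hρ1 hρ hdiag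
    have hmonoY := euclidLogMonopole_diagEnergy_le L y q hq ρ
    have hmonoX := euclidLogMonopole_diagEnergy_le L x q hq ρ
    simp only [hA, hB]
    rw [hsplit]
    linarith
  · intro u hu
    have hux1 : torusDist u x ≤ 1 := torusDist_le_one_of_torusNormSq_le_oneT hu
    have huy : ρ ≤ torusDist u y := by
      have := torusDist_triangle' x u y
      rw [torusDist_comm' x u] at this
      omega
    have hBu : B u = 0 := by
      simp only [hB]
      rw [euclidLogProfile_of_le_oneT _ _ hu, mul_zero]
    have hAu : A u = q * Real.log ρ := by simp only [hA, hsat u y huy]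
    show A u - B u = A x - B x
    rw [hAu, hBu, hAx, hBx]
  · intro v hv
    have hvy1 : torusDist v y ≤ 1 := torusDist_le_one_of_torusNormSq_le_oneT hv
    have hvx : ρ ≤ torusDist v x := by
      have := torusDist_triangle' x v y
      rw [torusDist_comm' x v] at this
      omega
    have hAv : A v = 0 := by
      simp only [hA]
      rw [euclidLogProfile_of_le_oneT _ _ hv, mul_zero]
    have hBv : B v = q * Real.log ρ := by simp only [hB, hsat v x hvx]
    show A v - B v = A y - B y
    rw [hAv, hBv, hAy, hBy]

/-! ### Generic step: flat two-graph a priori bound ⟹ sharp power law -/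

/-- **From a FLAT two-graph a priori gauge bound to the Euclidean-dipole power law.** If `g`
obeys `g ≤ e^{-c(φ_x - φ_y)} exp[b(a₁ Σ_{n.n.} + a₂ Σ_{diag})(cosh(φ_u - φ_v) - 1)]`
(`b, a₁, a₂ ≥ 0`) for every real `φ` on `(ℤ/Lℤ)²` constant on `{u : |u-x|₂² ≤ 1}` and on
`{v : |v-y|₂² ≤ 1}`, then for every `q ≥ 0` with `f = 2cq - 4πb(a₁ + 2a₂)q² ≥ 0`:
`g ≤ exp[2b(a₁(2πq²+76q²+544q⁴e^{2q²}) + a₂(4πq²+289q²+3402q⁴e^{2q²}))] 5^f (dist(x,y)+1)^{-f}`.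
Koma–Tasaki, PRL 68 (1992) 3248, eqs. (12)–(13) with note 9.
[cite: KomaTasakiPRL1992, eqs. (12)–(13) and note 9] -/
theorem le_rpow_euclid_two_graphs_of_apriori_flat (L : ℕ) [NeZero L]
    (b a₁ a₂ c q g f : ℝ) (hb : 0 ≤ b) (ha₁ : 0 ≤ a₁) (ha₂ : 0 ≤ a₂) (hq : 0 ≤ q)
    (x y : TorusSite 2 L)
    (hAP : ∀ φ : TorusSite 2 L → ℝ, (∀ u, torusNormSq (u - x) ≤ 1 → φ u = φ x) →
      (∀ v, torusNormSq (v - y) ≤ 1 → φ v = φ y) →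
      g ≤ Real.exp (-(c * (φ x - φ y))) * Real.exp (b * (a₁ *
          (∑ u : TorusSite 2 L, ∑ v : TorusSite 2 L,
            (if (torusGraph 2 L).Adj u v then (Real.cosh (φ u - φ v) - 1) else 0)) +
        a₂ * ∑ u : TorusSite 2 L, ∑ v : TorusSite 2 L,
            (if (torusDiagGraph L).Adj u v then (Real.cosh (φ u - φ v) - 1) else 0))))
    (hfq : f = 2 * c * q - 4 * Real.pi * (b * (a₁ + 2 * a₂)) * q ^ 2) (hf : 0 ≤ f) :
    g ≤ Real.exp (2 * b * (a₁ * (2 * Real.pi * q ^ 2 + 76 * q ^ 2 +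
            544 * q ^ 4 * Real.exp (2 * q ^ 2)) +
          a₂ * (4 * Real.pi * q ^ 2 + 289 * q ^ 2 + 3402 * q ^ 4 * Real.exp (2 * q ^ 2)))) *
        ((5 : ℝ) ^ f * ((torusDist x y : ℝ) + 1) ^ (-f)) := by
  set K : ℝ := Real.exp (2 * b * (a₁ * (2 * Real.pi * q ^ 2 + 76 * q ^ 2 +
      544 * q ^ 4 * Real.exp (2 * q ^ 2)) +
    a₂ * (4 * Real.pi * q ^ 2 + 289 * q ^ 2 + 3402 * q ^ 4 * Real.exp (2 * q ^ 2)))) with hK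
  have hK1 : 1 ≤ K := Real.one_le_exp (by positivity)
  set R : ℕ := torusDist x y with hR
  have hR1 : (0 : ℝ) < (R : ℝ) + 1 := by positivity
  by_cases hR3 : R < 3
  · have h0 := hAP (fun _ => 0) (fun _ _ => rfl) (fun _ _ => rfl)
    simp only [sub_self, mul_zero, neg_zero, Real.cosh_zero, ite_self, sum_const_zero, add_zero,
      Real.exp_zero, mul_one] at h0
    have hge1 : 1 ≤ (5 : ℝ) ^ f * ((R : ℝ) + 1) ^ (-f) := by
      rw [Real.rpow_neg hR1.le, ← div_eq_mul_inv, ← Real.div_rpow (by norm_num) hR1.le]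
      refine Real.one_le_rpow ?_ hf
      rw [le_div_iff₀ hR1]
      have : (R : ℝ) ≤ 2 := by exact_mod_cast (by omega : R ≤ 2)
      linarith
    calc g ≤ 1 := h0
      _ ≤ K * ((5 : ℝ) ^ f * ((R : ℝ) + 1) ^ (-f)) := by nlinarith
  · have hR3' : 3 ≤ R := not_lt.1 hR3
    set ρ : ℕ := (R - 1) / 2 with hρdef
    have hρ1 : 1 ≤ ρ := by omega
    have hρR : 2 * ρ + 1 ≤ torusDist x y := by rw [← hR]; omega
    have h5ρ : R + 1 ≤ 5 * ρ := by omega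
    obtain ⟨φ, hgain, hE₁, hE₂, hfx, hfy⟩ :=
      exists_euclidLogDipole_two_graphs_flat L x y q hq ρ hρ1 hρR
    have key := hAP φ hfx hfy
    rw [hgain] at key
    have hρ0 : (0 : ℝ) < (ρ : ℝ) := by exact_mod_cast hρ1
    have hH : (harmonic ρ : ℝ) ≤ 1 + Real.log ρ := harmonic_le_one_add_log ρ
    have hfifth : ((R : ℝ) + 1) / 5 ≤ (ρ : ℝ) := by
      have h' : ((R : ℝ) + 1) ≤ 5 * (ρ : ℝ) := by exact_mod_cast h5ρ
      linarith
    have hfifth0 : (0 : ℝ) < ((R : ℝ) + 1) / 5 := by positivity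
    calc g ≤ Real.exp (-(c * (2 * q * Real.log ρ))) * Real.exp (b * (a₁ *
            (∑ u : TorusSite 2 L, ∑ v : TorusSite 2 L,
              (if (torusGraph 2 L).Adj u v then (Real.cosh (φ u - φ v) - 1) else 0)) +
            a₂ * ∑ u : TorusSite 2 L, ∑ v : TorusSite 2 L,
              (if (torusDiagGraph L).Adj u v then (Real.cosh (φ u - φ v) - 1) else 0))) := key
      _ ≤ Real.exp (-(c * (2 * q * Real.log ρ))) * Real.exp (b * (a₁ *
            (2 * (2 * Real.pi * q ^ 2 * (harmonic ρ : ℝ) + 76 * q ^ 2 +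
              544 * q ^ 4 * Real.exp (2 * q ^ 2))) +
            a₂ * (2 * (4 * Real.pi * q ^ 2 * (harmonic ρ : ℝ) + 289 * q ^ 2 +
              3402 * q ^ 4 * Real.exp (2 * q ^ 2))))) := by
          gcongr
      _ ≤ Real.exp (-(c * (2 * q * Real.log ρ))) * Real.exp (b * (a₁ *
            (2 * (2 * Real.pi * q ^ 2 * (1 + Real.log ρ) + 76 * q ^ 2 +
              544 * q ^ 4 * Real.exp (2 * q ^ 2))) +
            a₂ * (2 * (4 * Real.pi * q ^ 2 * (1 + Real.log ρ) + 289 * q ^ 2 +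
              3402 * q ^ 4 * Real.exp (2 * q ^ 2))))) := by
          gcongr
      _ = K * Real.exp (-(f * Real.log ρ)) := by
          rw [hK, ← Real.exp_add, ← Real.exp_add, hfq]
          congr 1
          ring
      _ = K * (ρ : ℝ) ^ (-f) := by
          rw [Real.rpow_def_of_pos hρ0]
          congr 2
          ring
      _ ≤ K * (((R : ℝ) + 1) / 5) ^ (-f) := by
          gcongr K * ?_
          exact Real.rpow_le_rpow_of_nonpos hfifth0 hfifth (by linarith)
      _ = K * ((5 : ℝ) ^ f * ((R : ℝ) + 1) ^ (-f)) := by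
          rw [Real.div_rpow hR1.le (by norm_num), Real.rpow_neg (by norm_num : (0:ℝ) ≤ 5),
            div_inv_eq_mul, mul_comm (((R : ℝ) + 1) ^ (-f))]

/-! ### The sharp power laws for bond pairs and pair fields of the `t–t'` model -/

/-- **Sharp Koma–Tasaki bound for bond pairs of the `t–t'` model on `(ℤ/Lℤ)²`.** For all real
`t, t', U, μ`, `β ≥ 0`, every `q ≥ 0` with `f := 4q - 4πβ(|t|+2|t'|)q² ≥ 0`, all sites `x, y`
and partners `x', y'` with `|x'-x|₂² ≤ 1`, `|y'-y|₂² ≤ 1`: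
`|⟨(b_{xx'})† b_{yy'}⟩_{β,L}| ≤ 4 K(q) 5^f (dist(x,y)+1)^{-f}`, uniformly in `L`.
[cite: KomaTasakiPRL1992, Theorem eq. (2), note 9, footnote [10], eqs. (5)–(13)] -/
theorem norm_thermalCorr_bondPair_ttPrime_le_rpow_sharp (L : ℕ) [NeZero L]
    (t t' U μ β q : ℝ) (hβ : 0 ≤ β) (hq : 0 ≤ q)
    (hf : 0 ≤ 4 * q - 4 * Real.pi * (β * (|t| + 2 * |t'|)) * q ^ 2)
    (x x' y y' : TorusSite 2 L) (hx' : torusNormSq (x' - x) ≤ 1)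
    (hy' : torusNormSq (y' - y) ≤ 1) :
    ‖(hubbardTorusTT' L t t' U - (μ : ℂ) • totalNumber).thermalCorr β
        (bondPair (FermionTorus.ofTorusSite x) (FermionTorus.ofTorusSite x'))ᴴ
        (bondPair (FermionTorus.ofTorusSite y) (FermionTorus.ofTorusSite y'))‖ ≤
      4 * (Real.exp (2 * β * (|t| * (2 * Real.pi * q ^ 2 + 76 * q ^ 2 +
            544 * q ^ 4 * Real.exp (2 * q ^ 2)) +
          |t'| * (4 * Real.pi * q ^ 2 + 289 * q ^ 2 + 3402 * q ^ 4 * Real.exp (2 * q ^ 2)))) *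
        ((5 : ℝ) ^ (4 * q - 4 * Real.pi * (β * (|t| + 2 * |t'|)) * q ^ 2) *
          ((torusDist x y : ℝ) + 1) ^ (-(4 * q - 4 * Real.pi * (β * (|t| + 2 * |t'|)) * q ^ 2)))) := by
  set g : ℝ := ‖(hubbardTorusTT' L t t' U - (μ : ℂ) • totalNumber).thermalCorr β
        (bondPair (FermionTorus.ofTorusSite x) (FermionTorus.ofTorusSite x'))ᴴ
        (bondPair (FermionTorus.ofTorusSite y) (FermionTorus.ofTorusSite y'))‖ with hg
  have h4 : g / 4 ≤ Real.exp (2 * β * (|t| * (2 * Real.pi * q ^ 2 + 76 * q ^ 2 +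
            544 * q ^ 4 * Real.exp (2 * q ^ 2)) +
          |t'| * (4 * Real.pi * q ^ 2 + 289 * q ^ 2 + 3402 * q ^ 4 * Real.exp (2 * q ^ 2)))) *
        ((5 : ℝ) ^ (4 * q - 4 * Real.pi * (β * (|t| + 2 * |t'|)) * q ^ 2) *
          ((torusDist x y : ℝ) + 1) ^
            (-(4 * q - 4 * Real.pi * (β * (|t| + 2 * |t'|)) * q ^ 2))) := by
    refine le_rpow_euclid_two_graphs_of_apriori_flat L β |t| |t'| 2 q (g / 4) _ hβ
      (abs_nonneg t) (abs_nonneg t') hq x y (fun φ hfx hfy => ?_) (by ring) hf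
    rw [div_le_iff₀ (by norm_num : (0 : ℝ) < 4)]
    have := norm_thermalCorr_bondPair_ttPrime_le_exp_sharp L t t' U μ hβ φ x x' y y'
      (hfx x' hx') (hfy y' hy')
    calc g ≤ _ := this
      _ = _ := by ring
  linarith

/-- For a step `e ∈ {0, ±e₁, ±e₂}`, `|proj e|₂² ≤ 1` on `(ℤ/Lℤ)²`. [folklore] -/
private theorem torusNormSq_proj_le_oneT (L : ℕ) [NeZero L] {e : Site 2}
    (he : e ∈ insert (0 : Site 2) unitSteps) : torusNormSq (Torus.proj L e) ≤ 1 := by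
  have hmax : torusNorm (Torus.proj L e : TorusSite 2 L) ≤ 1 :=
    torusNorm_proj_le_one L (apply_mem_insert_unitSteps he)
  rw [torusNorm_two_eq_max] at hmax
  have h0 : min ((Torus.proj L e : TorusSite 2 L) 0).val
      (L - ((Torus.proj L e : TorusSite 2 L) 0).val) ≤ 1 := le_trans (le_max_left _ _) hmax
  have h1 : min ((Torus.proj L e : TorusSite 2 L) 1).val
      (L - ((Torus.proj L e : TorusSite 2 L) 1).val) ≤ 1 := le_trans (le_max_right _ _) hmax
  have hz : e 0 = 0 ∨ e 1 = 0 := by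
    simp only [unitSteps, mem_insert, mem_singleton] at he
    rcases he with rfl | rfl | rfl | rfl | rfl <;> simp
  unfold torusNormSq
  rcases hz with h | h
  · have hc : ((Torus.proj L e : TorusSite 2 L) 0) = 0 := by simp [Torus.proj_apply, h]
    have hm0 : min (0 : ℕ) (L - 0) = 0 := by simp
    rw [hc, ZMod.val_zero, hm0]
    simpa using Nat.pow_le_pow_left h1 2
  · have hc : ((Torus.proj L e : TorusSite 2 L) 1) = 0 := by simp [Torus.proj_apply, h]
    have hm0 : min (0 : ℕ) (L - 0) = 0 := by simp
    rw [hc, ZMod.val_zero, hm0]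
    simpa using Nat.pow_le_pow_left h0 2

/-- A pair-field correlation is bounded by its bond-pair correlations: if every
`|⟨(b_{x,x+e})† b_{y,y+e'}⟩| ≤ 4D` (`e, e' ∈ {0, ±e₁, ±e₂}`) then
`|⟨(P_x)† P_y⟩| ≤ 4(Σ_e |g e/√2|)² D` (expansion of `P = Σ_e (g e/√2) b_{·,·+e}` and the
triangle inequality). [folklore] -/
private theorem norm_thermalCorr_localPair_le_of_bondPair (L : ℕ) [NeZero L]
    (g : Site 2 → ℝ) (β : ℝ)
    (H : Matrix (Finset (Orb (FermionTorus 2 L))) (Finset (Orb (FermionTorus 2 L))) ℂ)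
    (x y : TorusSite 2 L) (D : ℝ)
    (hb : ∀ e ∈ insert (0 : Site 2) unitSteps, ∀ e' ∈ insert (0 : Site 2) unitSteps,
      ‖H.thermalCorr β
          (bondPair (FermionTorus.ofTorusSite x)
            (FermionTorus.ofTorusSite (x + Torus.proj L e)))ᴴ
          (bondPair (FermionTorus.ofTorusSite y)
            (FermionTorus.ofTorusSite (y + Torus.proj L e')))‖ ≤ 4 * D) :
    ‖H.thermalCorr β (localPair g L x)ᴴ (localPair g L y)‖ ≤
      4 * (∑ e ∈ insert (0 : Site 2) unitSteps, |g e / Real.sqrt 2|) ^ 2 * D := by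
  set S : Finset (Site 2) := insert (0 : Site 2) unitSteps with hS
  set a : Site 2 → ℝ := fun e => g e / Real.sqrt 2 with ha
  rw [thermalCorr_localPair_eq]
  have hterm : ∀ e ∈ S, ∀ e' ∈ S,
      ‖((a e : ℝ) : ℂ) * ((a e' : ℝ) : ℂ) *
        H.thermalCorr β
          (bondPair (FermionTorus.ofTorusSite x)
            (FermionTorus.ofTorusSite (x + Torus.proj L e)))ᴴ
          (bondPair (FermionTorus.ofTorusSite y)
            (FermionTorus.ofTorusSite (y + Torus.proj L e')))‖ ≤
        |a e| * |a e'| * (4 * D) := by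
    intro e he e' he'
    rw [norm_mul, norm_mul, Complex.norm_real, Complex.norm_real, Real.norm_eq_abs,
      Real.norm_eq_abs]
    exact mul_le_mul_of_nonneg_left (hb e he e' he') (by positivity)
  calc ‖∑ e ∈ S, ∑ e' ∈ S, ((a e : ℝ) : ℂ) * ((a e' : ℝ) : ℂ) *
        H.thermalCorr β
          (bondPair (FermionTorus.ofTorusSite x)
            (FermionTorus.ofTorusSite (x + Torus.proj L e)))ᴴ
          (bondPair (FermionTorus.ofTorusSite y)
            (FermionTorus.ofTorusSite (y + Torus.proj L e')))‖
      ≤ ∑ e ∈ S, ∑ e' ∈ S, |a e| * |a e'| * (4 * D) := by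
        refine (norm_sum_le _ _).trans (Finset.sum_le_sum fun e he => ?_)
        exact (norm_sum_le _ _).trans (Finset.sum_le_sum fun e' he' => hterm e he e' he')
    _ = 4 * (∑ e ∈ S, |a e|) ^ 2 * D := by
        rw [sq, Finset.sum_mul_sum, Finset.mul_sum, Finset.sum_mul]
        refine Finset.sum_congr rfl fun e _ => ?_
        rw [Finset.mul_sum, Finset.sum_mul]
        refine Finset.sum_congr rfl fun e' _ => ?_
        ring

/-- **Sharp power-law decay of thermal pair-field correlations of the `t–t'` Hubbard model in
two dimensions, EVERY form factor** (Koma–Tasaki's Theorem with note 9 and footnote [10]): for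
every `g : ℤ² → ℝ`, all real `t, t', U, μ`, `β ≥ 0`, every `q ≥ 0` with
`f := 4q - 4πβ(|t|+2|t'|)q² ≥ 0`, uniformly in the side `L`:
`|⟨(P_x)† P_y⟩_{β,L}| ≤ 4(Σ_e |g e/√2|)² K(q) 5^f (dist(x,y)+1)^{-f}` — exponent up to
`T/(π(|t|+2|t'|))` at `q = 1/(2πβ(|t|+2|t'|))`.
[cite: KomaTasakiPRL1992, Theorem eq. (2), note 9 and footnote [10]] [cite: SuSuzuki1998, abstract]
[cite: XuEtAl2024, eq. (1)] -/
theorem norm_thermalCorr_localPair_ttPrime_le_sharp (L : ℕ) [NeZero L] (g : Site 2 → ℝ)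
    (t t' U μ β q : ℝ) (hβ : 0 ≤ β) (hq : 0 ≤ q)
    (hf : 0 ≤ 4 * q - 4 * Real.pi * (β * (|t| + 2 * |t'|)) * q ^ 2) (x y : TorusSite 2 L) :
    ‖(hubbardTorusTT' L t t' U - (μ : ℂ) • totalNumber).thermalCorr β
        (localPair g L x)ᴴ (localPair g L y)‖ ≤
      4 * (∑ e ∈ insert (0 : Site 2) unitSteps, |g e / Real.sqrt 2|) ^ 2 *
        (Real.exp (2 * β * (|t| * (2 * Real.pi * q ^ 2 + 76 * q ^ 2 +
            544 * q ^ 4 * Real.exp (2 * q ^ 2)) +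
          |t'| * (4 * Real.pi * q ^ 2 + 289 * q ^ 2 + 3402 * q ^ 4 * Real.exp (2 * q ^ 2)))) *
        ((5 : ℝ) ^ (4 * q - 4 * Real.pi * (β * (|t| + 2 * |t'|)) * q ^ 2) *
          ((torusDist x y : ℝ) + 1) ^
            (-(4 * q - 4 * Real.pi * (β * (|t| + 2 * |t'|)) * q ^ 2)))) := by
  refine norm_thermalCorr_localPair_le_of_bondPair L g β _ x y _ fun e he e' he' => ?_
  refine norm_thermalCorr_bondPair_ttPrime_le_rpow_sharp L t t' U μ β q hβ hq hf x _ y _ ?_ ?_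
  · rw [add_sub_cancel_left]; exact torusNormSq_proj_le_oneT L he
  · rw [add_sub_cancel_left]; exact torusNormSq_proj_le_oneT L he'

/-- The a priori bound with `φ = 0` for the `t–t'` model: `|⟨(P_x)† P_y⟩_{β,L}| ≤ 4(Σ_e |g e/√2|)²`
(Koma–Tasaki's eq. (12) at `φ = 0`). [cite: KomaTasakiPRL1992, eq. (12), note 9 and footnote [10]] -/
theorem norm_thermalCorr_localPair_ttPrime_le_apriori (L : ℕ) [NeZero L] (g : Site 2 → ℝ)
    (t t' U μ β : ℝ) (hβ : 0 ≤ β) (x y : TorusSite 2 L) :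
    ‖(hubbardTorusTT' L t t' U - (μ : ℂ) • totalNumber).thermalCorr β
        (localPair g L x)ᴴ (localPair g L y)‖ ≤
      4 * (∑ e ∈ insert (0 : Site 2) unitSteps, |g e / Real.sqrt 2|) ^ 2 := by
  have h := norm_thermalCorr_localPair_ttPrime_le_sharp L g t t' U μ β 0 hβ le_rfl
    (by norm_num) x y
  simp only [mul_zero, zero_pow (two_ne_zero), zero_pow (by norm_num : 4 ≠ 0), add_zero,
    Real.exp_zero, sub_zero, Real.rpow_zero, neg_zero, mul_one] at h
  simpa using h

end Torus

end Literature.MathematicalPhysics.QuantumLattice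

end
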